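import Summits.ResolutionOfSingularities.ResolutionOfSingularities.Theorems.WeightedInvariantIota3EpsEssSmooth
import HarnessLib

/-!
# (c11) for the `(ν ; ε)`-STRATUM: the top `iotaOrdEps`-stratum and its generic prime are COMPATIBLE WITH ESSENTIALLY SMOOTH LOCAL
# HOMOMORPHISMS — res-D-brk-1's `ContactCylinder.topStratum_iotaOrd_map` (p526917) one letter up — door `HypersurfaceCentreConstruction`
# (stmt-ResolutionOfSingularities-19897), route `WeightedInvariant`, rung P3, IOTA3-DESIGN v1 §2.3 «the generic reading: topStratumPrime transports»

[OURS · L1 W4.3 · cell `res-hironaka`, HUMAN RULING D-0089] Helper file `--supports stmt-ResolutionOfSingularities-19897`, res-type-013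
(sequel to ORDER (o32-ι-a″), OFFER 2026-08-27T11:58:33Z on HOME/STATUS).  Def-free; pure commutative algebra over the tree; no named facts.
NOT a statement of the manuscript under review (Hironaka 2017, [claim: Hironaka2017, status: under-review]); nothing here claims anything about
resolution of singularities; AI work, weaker than expert review.

The generic reading of the third letter (`ContactCylinder.iotaCylinder iotaOrdEps σ`, res-type-061 p527951) and the cylinder centre
(`ContactCylinder.jCylinder iotaOrdEps J`, res-type-005 p524206) are read at the generic prime `P₀ = topStratumPrime iotaOrdEps S f` of the
top `(ν ; ε)`-stratum; their (c11) clauses therefore need `P₀` to transport along the maps `φ : S → S′` of (c11) (local, formally smooth,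
essentially of finite type, regular local rings).  This file supplies that transport:

* `iotaEps_atPrime_eq_iotaEps_atPrime_comap` — `ε(S′_{𝔮′}, φ f) = ε(S_{𝔮′ ∩ S}, f)` for every prime `𝔮′` of `S′` (the localised pair is again a
  (c11)-map — res-D-brk-1's instance block — and `iotaEps_essSmooth_eq` (p528660) applies; likewise for the pair, `iotaOrdEps_atPrime_eq_…`);
* `mem_topStratum_iotaOrdEps_map_iff`, **`topStratum_iotaOrdEps_map`** — `topStratum iotaOrdEps S′ (φ f) = (Spec φ)⁻¹ (topStratum iotaOrdEps S f)`;
  `topStratum_iotaOrdEps_map_of_eq` — `V(P) ↦ V(P S′)`;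
* **`topStratumPrime_iotaOrdEps_map_eq`** — if the top `(ν ; ε)`-stratum of `S` is `V(P)` with `S ⧸ P` regular (at every P3 position:
  res-type-078's `Iota3.topStratum_iotaOrdEps_eq`, p528738), then `topStratumPrime iotaOrdEps S′ (φ f) = P S′`, which is PRIME with
  `S′ ⧸ P S′` regular (`isRegularLocalRing_quotient_map_of_isRegularLocalRing_quotient`, p528660).

## References

* H. Matsumura, *Commutative Ring Theory*, CUP 1986, §22 Cor. to Thm. 22.5, Thm. 23.7. [Matsumura1987]
* res-L1-w43-plan-1, `IOTA3-DESIGN.md` v1.2 §2.3 (OURS, AI planning).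
-/

noncomputable section

set_option linter.dupNamespace false -- mandated namespace `Summit.<Summit>.<Problem>` of this single-conjunct summit

open IsLocalRing Literature.AlgebraicGeometry.Resolution
open Summit.ResolutionOfSingularities.ResolutionOfSingularities.Theorems (ContactCylinder.topStratum ContactCylinder.topStratumPrime)
open Summit.ResolutionOfSingularities.ResolutionOfSingularities.Theorems.ContactCylinder

namespace Summit.ResolutionOfSingularities.ResolutionOfSingularities.Cruxes.HypersurfaceCentreConstruction.LocalEngine

namespace Iota3

section EssSmooth

variable (S S' : Type) [CommRing S] [CommRing S'] [IsRegularLocalRing S] [IsRegularLocalRing S'] [Algebra S S']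
  [IsLocalHom (algebraMap S S')] [Algebra.FormallySmooth S S'] [Algebra.EssFiniteType S S']

omit [IsLocalHom (algebraMap S S')] in
/-- **`ε(S′_{𝔮′}) = ε(S_{𝔮′ ∩ S})`** along an essentially smooth local homomorphism of regular local rings, for every prime `𝔮′` of `S′`:
the localised homomorphism `S_{𝔮′ ∩ S} → S′_{𝔮′}` is local, formally smooth, essentially of finite type between regular local rings
(res-D-brk-1's instance block of `iotaOrd_atPrime_eq_iotaOrd_atPrime_comap`), so `iotaEps_essSmooth_eq` (p528660) applies to it.
[cite: Matsumura1987, Thm. 23.7] -/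
theorem iotaEps_atPrime_eq_iotaEps_atPrime_comap (f : S) (𝔮' : Ideal S') [𝔮'.IsPrime] :
    iotaEps (Localization.AtPrime 𝔮') (algebraMap S (Localization.AtPrime 𝔮') f) =
      iotaEps (Localization.AtPrime (𝔮'.comap (algebraMap S S')))
        (algebraMap S (Localization.AtPrime (𝔮'.comap (algebraMap S S'))) f) := by
  haveI : IsRegularLocalRing (Localization.AtPrime 𝔮') := isRegularLocalRing_localization_atPrime S' 𝔮'
  haveI : IsRegularLocalRing (Localization.AtPrime (𝔮'.comap (algebraMap S S'))) :=
    isRegularLocalRing_localization_atPrime S _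
  letI : Algebra (Localization.AtPrime (𝔮'.comap (algebraMap S S'))) (Localization.AtPrime 𝔮') :=
    (Localization.localRingHom (𝔮'.comap (algebraMap S S')) 𝔮' (algebraMap S S') rfl).toAlgebra
  haveI : IsScalarTower S (Localization.AtPrime (𝔮'.comap (algebraMap S S'))) (Localization.AtPrime 𝔮') :=
    IsScalarTower.of_algebraMap_eq fun s => by
      change _ = Localization.localRingHom (𝔮'.comap (algebraMap S S')) 𝔮' (algebraMap S S') rfl (algebraMap S _ s)
      rw [Localization.localRingHom_to_map, IsScalarTower.algebraMap_apply S S' (Localization.AtPrime 𝔮')]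
  haveI : IsLocalHom (algebraMap (Localization.AtPrime (𝔮'.comap (algebraMap S S'))) (Localization.AtPrime 𝔮')) :=
    Localization.isLocalHom_localRingHom _ 𝔮' (algebraMap S S') rfl
  haveI : Algebra.FormallySmooth S (Localization.AtPrime 𝔮') := Algebra.FormallySmooth.comp S S' _
  haveI : Algebra.EssFiniteType S (Localization.AtPrime 𝔮') := Algebra.EssFiniteType.comp S S' _
  haveI : Algebra.FormallySmooth (Localization.AtPrime (𝔮'.comap (algebraMap S S'))) (Localization.AtPrime 𝔮') :=
    Algebra.FormallySmooth.localization_base (𝔮'.comap (algebraMap S S')).primeCompl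
  haveI : Algebra.EssFiniteType (Localization.AtPrime (𝔮'.comap (algebraMap S S'))) (Localization.AtPrime 𝔮') :=
    Algebra.EssFiniteType.of_comp S _ _
  rw [IsScalarTower.algebraMap_apply S (Localization.AtPrime (𝔮'.comap (algebraMap S S'))) (Localization.AtPrime 𝔮') f]
  exact iotaEps_essSmooth_eq _ _ _

omit [IsLocalHom (algebraMap S S')] in
/-- The same for the pair `(ν ; ε)`. [cite: Matsumura1987, Thm. 23.7] -/
theorem iotaOrdEps_atPrime_eq_iotaOrdEps_atPrime_comap (f : S) (𝔮' : Ideal S') [𝔮'.IsPrime] :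
    iotaOrdEps (Localization.AtPrime 𝔮') (algebraMap S (Localization.AtPrime 𝔮') f) =
      iotaOrdEps (Localization.AtPrime (𝔮'.comap (algebraMap S S')))
        (algebraMap S (Localization.AtPrime (𝔮'.comap (algebraMap S S'))) f) := by
  rw [iotaOrdEps_apply, iotaOrdEps_apply, iotaOrd_atPrime_eq_iotaOrd_atPrime_comap S S' f 𝔮',
    iotaEps_atPrime_eq_iotaEps_atPrime_comap S S' f 𝔮']

/-- A prime `𝔮′` of `S′` lies on the top `(ν ; ε)`-stratum of `φ f` iff its contraction lies on the top `(ν ; ε)`-stratum of `f`.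
[OURS · L1 W4.3, kernel] -/
theorem mem_topStratum_iotaOrdEps_map_iff (f : S) (𝔮' : PrimeSpectrum S') :
    𝔮' ∈ topStratum iotaOrdEps S' (algebraMap S S' f) ↔
      PrimeSpectrum.comap (algebraMap S S') 𝔮' ∈ topStratum iotaOrdEps S f := by
  rw [Theorems.ContactCylinder.mem_topStratum_iff, Theorems.ContactCylinder.mem_topStratum_iff, iotaOrdEps_essSmooth_eq S S' f,
    ← IsScalarTower.algebraMap_apply S S' (Localization.AtPrime 𝔮'.asIdeal) f,
    iotaOrdEps_atPrime_eq_iotaOrdEps_atPrime_comap S S' f 𝔮'.asIdeal]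
  exact Iff.rfl

/-- **THE TOP `(ν ; ε)`-STRATUM IS COMPATIBLE WITH ESSENTIALLY SMOOTH BASE CHANGE**:
`topStratum iotaOrdEps S′ (φ f) = (Spec φ)⁻¹ (topStratum iotaOrdEps S f)` (every dimension). [OURS · L1 W4.3, kernel] -/
theorem topStratum_iotaOrdEps_map (f : S) :
    topStratum iotaOrdEps S' (algebraMap S S' f) = PrimeSpectrum.comap (algebraMap S S') ⁻¹' topStratum iotaOrdEps S f := by
  ext 𝔮'
  exact mem_topStratum_iotaOrdEps_map_iff S S' f 𝔮'

/-- If the top `(ν ; ε)`-stratum of `S` is `V(P)`, that of `S′` is `V(P S′)`. [OURS · L1 W4.3, kernel] -/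
theorem topStratum_iotaOrdEps_map_of_eq (f : S) {P : Ideal S} (hE : topStratum iotaOrdEps S f = {𝔮 | P ≤ 𝔮.asIdeal}) :
    topStratum iotaOrdEps S' (algebraMap S S' f) = {𝔮' | P.map (algebraMap S S') ≤ 𝔮'.asIdeal} := by
  ext 𝔮'
  rw [mem_topStratum_iotaOrdEps_map_iff, hE, Set.mem_setOf_eq, Set.mem_setOf_eq, Ideal.map_le_iff_le_comap]
  exact Iff.rfl

/-- **THE GENERIC PRIME OF THE TOP `(ν ; ε)`-STRATUM TRANSPORTS** along an essentially smooth local homomorphism: if the top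
`(ν ; ε)`-stratum of `S` through the closed point is `V(P)` with `S ⧸ P` a regular local ring (at every P3 position, by res-type-078's
`Iota3.topStratum_iotaOrdEps_eq`, p528738), then `topStratumPrime iotaOrdEps S′ (φ f) = P S′`, and `P S′` is PRIME with `S′ ⧸ P S′` regular
(ascent of regularity along the centre, p528660). [OURS · L1 W4.3, kernel] -/
theorem topStratumPrime_iotaOrdEps_map_eq (f : S) {P : Ideal S} [P.IsPrime] (hreg : IsRegularLocalRing (S ⧸ P))
    (hE : topStratum iotaOrdEps S f = {𝔮 | P ≤ 𝔮.asIdeal}) :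
    (P.map (algebraMap S S')).IsPrime ∧ IsRegularLocalRing (S' ⧸ P.map (algebraMap S S')) ∧
      topStratum iotaOrdEps S' (algebraMap S S' f) = {𝔮' | P.map (algebraMap S S') ≤ 𝔮'.asIdeal} ∧
      topStratumPrime iotaOrdEps S' (algebraMap S S' f) = P.map (algebraMap S S') := by
  haveI hP' := isPrime_map_of_isRegularLocalRing_quotient S S' P hreg
  have hE' := topStratum_iotaOrdEps_map_of_eq S S' f hE
  exact ⟨hP', isRegularLocalRing_quotient_map_of_isRegularLocalRing_quotient S S' P hreg, hE',
    Summit.ResolutionOfSingularities.ResolutionOfSingularities.Theorems.ContactCylinder.topStratumPrime_eq_of_topStratum_eq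
      iotaOrdEps S' _ hE'⟩

end EssSmooth

end Iota3

end Summit.ResolutionOfSingularities.ResolutionOfSingularities.Cruxes.HypersurfaceCentreConstruction.LocalEngine

end
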